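import Literature.NumberTheory.PAdicHodge.DeRhamInductionDescent
import Literature.NumberTheory.GaloisRepresentations.FramedRepBlockSum
import HarnessLib

/-!
# A block sum of two framed representations is de Rham iff both summands are
# (Fontaine, Astérisque 223, Exp. III Prop. 1.5.2: direct sums AND direct summands)

Topic `NumberTheory/PAdicHodge`.  PROOF FILE (theorems only: no definition, no named fact, no
instance; D-0026).  For a `ℚ_ℓ`-algebra structure `alg` on a field `F`, a period-ring datum `𝔅`
for `Γ_F` and continuous framed `ρ₁, ρ₂ : Γ_F → GL_n(ℚ̄_ℓ)` of the same size,

  `(ρ₁ ⊞ ρ₂).IsDeRhamWith alg 𝔅 ↔ ρ₁.IsDeRhamWith alg 𝔅 ∧ ρ₂.IsDeRhamWith alg 𝔅`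

(`FramedRep.isDeRhamWith_blockSum_iff`): the block sum `FramedRep.blockSum` (file
`FramedRepBlockSum`) is block diagonal along the relabelling `Fin 2 × Fin n ≃ Fin (n + n)`,
`(0, i) ↦ i`, `(1, i) ↦ n + i`, with blocks `ρ₁, ρ₂`, so the accepted
`FramedRep.IsDeRhamWith.of_blockDiagonal` (sums) and `FramedRep.IsDeRhamWith.block_of_blockDiagonal`
(summands) apply.  Corollaries: the same for a `p`-adic Hodge datum
(`PstWeilDeligneData.isDeRhamFramed_blockSum_iff`) and, for a number field `K` and THE pinned
Fontaine data at a place `v ∣ ℓ`, `isDeRhamFramed_toLocal_blockSum_iff`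
(`FramedGaloisRep.toLocal_blockSum`).
-- TODO(general form): summands of different sizes `m ≠ n` (needs the binary-product form of
-- `PeriodRingData.isAdmissible_pi_iff` and the corresponding model descent).

## References

* [FontaineAsterisque223III] J.-M. Fontaine, *Représentations p-adiques semi-stables*, Astérisque
  223 (1994), Exp. III §1.5, Prop. 1.5.2.
* [BrinonConrad2009] O. Brinon, B. Conrad, *CMI Summer School notes on p-adic Hodge theory*
  (2009), Thm. 5.2.1 and Prop. 6.3.8.
-/

noncomputable section

open scoped NumberField
open Field Literature.NumberTheory.GaloisRepresentations

namespace Literature.NumberTheory.GaloisRepresentations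

open Literature.NumberTheory.PAdicHodge

section Local

variable {F : Type} [Field F] {ℓ : ℕ} [Fact ℓ.Prime]

/-- **`ρ₁ ⊞ ρ₂` is de Rham iff `ρ₁` and `ρ₂` are** (Fontaine, Exposé III, Prop. 1.5.2, for THE
framed block sum of two representations of the same size and the accepted `FramedRep.IsDeRhamWith`):
`ρ₁ ⊞ ρ₂` is block diagonal along `Fin 2 × Fin n ≃ Fin (n + n)` with blocks `ρ₁, ρ₂`; then
`FramedRep.IsDeRhamWith.of_blockDiagonal` and `FramedRep.IsDeRhamWith.block_of_blockDiagonal`.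
[cite: FontaineAsterisque223III, Exp. III §1.5, Prop. 1.5.2] [cite: BrinonConrad2009, Thm. 5.2.1] -/
theorem FramedRep.isDeRhamWith_blockSum_iff (alg : Algebra ℚ_[ℓ] F)
    (𝔅 : PeriodRingData.{0, 0, 0, 0} (absoluteGaloisGroup F) ℚ_[ℓ] F) {n : ℕ}
    (ρ₁ ρ₂ : FramedRep (absoluteGaloisGroup F) (PadicAlgCl ℓ) n) :
    (ρ₁.blockSum ρ₂).IsDeRhamWith alg 𝔅 ↔ ρ₁.IsDeRhamWith alg 𝔅 ∧ ρ₂.IsDeRhamWith alg 𝔅 := by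
  classical
  -- the relabelling `Fin 2 × Fin n ≃ Fin n ⊕ Fin n ≃ Fin (n + n)`, `(0, i) ↦ inl i`, `(1, i) ↦ inr i`
  let e : Fin 2 × Fin n ≃ Fin (n + n) :=
    { toFun := fun x => finSumFinEquiv (if x.1 = 0 then Sum.inl x.2 else Sum.inr x.2)
      invFun := fun j =>
        Sum.elim (fun i => ((0 : Fin 2), i)) (fun i => ((1 : Fin 2), i)) (finSumFinEquiv.symm j)
      left_inv := fun x => by
        obtain ⟨k, i⟩ := x
        show Sum.elim (fun i => ((0 : Fin 2), i)) (fun i => ((1 : Fin 2), i))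
          (finSumFinEquiv.symm (finSumFinEquiv (if k = 0 then Sum.inl i else Sum.inr i))) = (k, i)
        rw [Equiv.symm_apply_apply]
        fin_cases k
        · simp
        · simp
      right_inv := fun j => by
        obtain ⟨x, rfl⟩ := finSumFinEquiv.surjective j
        show finSumFinEquiv (if (Sum.elim (fun i => ((0 : Fin 2), i)) (fun i => ((1 : Fin 2), i))
            (finSumFinEquiv.symm (finSumFinEquiv x))).1 = 0 then
          Sum.inl (Sum.elim (fun i => ((0 : Fin 2), i)) (fun i => ((1 : Fin 2), i))
            (finSumFinEquiv.symm (finSumFinEquiv x))).2 else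
          Sum.inr (Sum.elim (fun i => ((0 : Fin 2), i)) (fun i => ((1 : Fin 2), i))
            (finSumFinEquiv.symm (finSumFinEquiv x))).2) = finSumFinEquiv x
        rw [Equiv.symm_apply_apply]
        cases x
        · simp
        · simp }
  have he : ∀ x : Fin 2 × Fin n,
      e x = finSumFinEquiv (if x.1 = 0 then Sum.inl x.2 else Sum.inr x.2) := fun _ => rfl
  -- the blocks
  let B : Fin 2 → FramedRep (absoluteGaloisGroup F) (PadicAlgCl ℓ) n := ![ρ₁, ρ₂]
  have hB0 : B 0 = ρ₁ := rfl
  have hB1 : B 1 = ρ₂ := rfl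
  -- `ρ₁ ⊞ ρ₂` is block diagonal along `e` with blocks `B`
  have hT : ∀ g, (((ρ₁.blockSum ρ₂) g : GL (Fin (n + n)) (PadicAlgCl ℓ)) :
      Matrix (Fin (n + n)) (Fin (n + n)) (PadicAlgCl ℓ)) =
      Matrix.reindex e e (Matrix.comp (Fin 2) (Fin 2) (Fin n) (Fin n) (PadicAlgCl ℓ)
        (Matrix.diagonal fun i =>
          ((B i g : GL (Fin n) (PadicAlgCl ℓ)) : Matrix (Fin n) (Fin n) (PadicAlgCl ℓ)))) := by
    intro g
    ext x y
    obtain ⟨⟨k, i⟩, rfl⟩ := e.surjective x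
    obtain ⟨⟨k', j⟩, rfl⟩ := e.surjective y
    rw [Matrix.reindex_apply, Matrix.submatrix_apply, Equiv.symm_apply_apply,
      Equiv.symm_apply_apply, Matrix.comp_apply, FramedRep.coe_blockSum_apply,
      blockSumRingHom_apply, Matrix.reindex_apply, Matrix.submatrix_apply, he, he,
      Equiv.symm_apply_apply, Equiv.symm_apply_apply]
    fin_cases k <;> fin_cases k'
    · simp [hB0]
    · simp [Matrix.diagonal_apply_ne]
    · simp [Matrix.diagonal_apply_ne]
    · simp [hB1]
  refine ⟨fun h => ⟨?_, ?_⟩, fun h => ?_⟩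
  · exact hB0 ▸ FramedRep.IsDeRhamWith.block_of_blockDiagonal alg 𝔅 e hT h 0
  · exact hB1 ▸ FramedRep.IsDeRhamWith.block_of_blockDiagonal alg 𝔅 e hT h 1
  · refine FramedRep.IsDeRhamWith.of_blockDiagonal alg 𝔅 e hT fun i => ?_
    fin_cases i
    · exact h.1
    · exact h.2

/-- **`ρ₁ ⊞ ρ₂` is de Rham iff `ρ₁` and `ρ₂` are, for a `p`-adic Hodge datum** (accepted
`PstWeilDeligneData.IsDeRhamFramed`). [cite: FontaineAsterisque223III, Exp. III §1.5, Prop. 1.5.2] -/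
theorem PstWeilDeligneData.isDeRhamFramed_blockSum_iff [ValuativeRel F] [TopologicalSpace F]
    [IsNonarchimedeanLocalField F] (𝔇 : PstWeilDeligneData F ℓ) {n : ℕ}
    (ρ₁ ρ₂ : FramedRep (absoluteGaloisGroup F) (PadicAlgCl ℓ) n) :
    𝔇.IsDeRhamFramed (ρ₁.blockSum ρ₂) ↔ 𝔇.IsDeRhamFramed ρ₁ ∧ 𝔇.IsDeRhamFramed ρ₂ :=
  FramedRep.isDeRhamWith_blockSum_iff 𝔇.algebra 𝔇.𝔅 ρ₁ ρ₂

end Local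

end Literature.NumberTheory.GaloisRepresentations

namespace Literature.NumberTheory.PAdicHodge

section Pinned

open NumberField IsDedekindDomain

variable {K : Type} [Field K] [NumberField K] {ℓ : ℕ} [Fact ℓ.Prime]

/-- **`ρ₁ ⊞ ρ₂` is de Rham at `v ∣ ℓ` iff `ρ₁` and `ρ₂` are, for THE pinned Fontaine data** of a
number field `K`: restriction to the decomposition group commutes with block sums
(`FramedGaloisRep.toLocal_blockSum`), then `PstWeilDeligneData.isDeRhamFramed_blockSum_iff` for
`fontainePstAdicCompletion v ℓ hv`. [cite: FontaineAsterisque223III, Exp. III §1.5, Prop. 1.5.2] -/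
theorem isDeRhamFramed_toLocal_blockSum_iff {n : ℕ} (ρ₁ ρ₂ : FramedGaloisRep K (PadicAlgCl ℓ) n)
    (v : HeightOneSpectrum (𝓞 K)) (hv : ((ℓ : ℕ) : 𝓞 K) ∈ v.asIdeal) :
    (fontainePstAdicCompletion v ℓ hv).IsDeRhamFramed ((ρ₁.blockSum ρ₂).toLocal v) ↔
      (fontainePstAdicCompletion v ℓ hv).IsDeRhamFramed (ρ₁.toLocal v) ∧
        (fontainePstAdicCompletion v ℓ hv).IsDeRhamFramed (ρ₂.toLocal v) := by
  rw [FramedGaloisRep.toLocal_blockSum]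
  exact (fontainePstAdicCompletion v ℓ hv).isDeRhamFramed_blockSum_iff (ρ₁.toLocal v) (ρ₂.toLocal v)

/-- Hence **`ρ₁ ⊞ ρ₂` is de Rham at every place above `ℓ` iff `ρ₁` and `ρ₂` are.**
[cite: FontaineAsterisque223III, Exp. III §1.5, Prop. 1.5.2] -/
theorem forall_isDeRhamFramed_toLocal_blockSum_iff {n : ℕ}
    (ρ₁ ρ₂ : FramedGaloisRep K (PadicAlgCl ℓ) n) :
    (∀ (v : HeightOneSpectrum (𝓞 K)) (hv : ((ℓ : ℕ) : 𝓞 K) ∈ v.asIdeal),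
        (fontainePstAdicCompletion v ℓ hv).IsDeRhamFramed ((ρ₁.blockSum ρ₂).toLocal v)) ↔
      (∀ (v : HeightOneSpectrum (𝓞 K)) (hv : ((ℓ : ℕ) : 𝓞 K) ∈ v.asIdeal),
          (fontainePstAdicCompletion v ℓ hv).IsDeRhamFramed (ρ₁.toLocal v)) ∧
        ∀ (v : HeightOneSpectrum (𝓞 K)) (hv : ((ℓ : ℕ) : 𝓞 K) ∈ v.asIdeal),
          (fontainePstAdicCompletion v ℓ hv).IsDeRhamFramed (ρ₂.toLocal v) := by
  simp only [isDeRhamFramed_toLocal_blockSum_iff]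
  exact ⟨fun h => ⟨fun v hv => (h v hv).1, fun v hv => (h v hv).2⟩,
    fun h v hv => ⟨h.1 v hv, h.2 v hv⟩⟩

end Pinned

end Literature.NumberTheory.PAdicHodge

end
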